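import Summits.QuantumFields.YangMills.Theorems.UnitScaleTiltFluctuationComparisonRegPrLevelCauchyMinT
import HarnessLib

/-!
# Crux-idea sketch (ideator 2, gen 9, lens NEGATION → reformulation; card C7 `finest-level-sink`) for `FluctuationComparisonRegPr[L]`
# (stmt-QuantumFields-19201 / -19935), line v5j′ STUB 3″′ `stub_pintDecompTwoRunMinFam` (OWNER RULING ym3-torus-plan g20-№3 §3, GO-2 08:49Z):
# **THE SINK** — the term-function freedom `∃ π PT` of `PintDecompTrivT D PT ∧ TwoRunMinT D PT b₀ p₀ a` absorbs the whole PER-POLYMER two-run structure;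
# what is left is ONE GLOBAL inequality on the TOTAL trivial-history interaction `K ↦ PintH D K n V`.

HEADLINE (§4, sorry-free) `exists_termFn_twoRunMinT_top`: for ANY datum `D` and ANY rate `a`,
  `PintZero D` (Pint at level 0 vanishes — `AlphaInputsT3AC.dataOfV3_pint_zero`, `rfl`, for the v3 family datum)
  `∧ PintDecompAboveT D PT₀` ((43) only in the socket's junk range `j > K`; a dump term function gives it)
  `∧ 0 < κ₁ ∧ LocCover D κ₁ C′ ∧ LocBlockVolume D ∧ LocMatched D ∧ TreeLenMatched D ∧ LocMass D κ₁ z` (GEOMETRY of `Loc`/`treeLen` only — all five hold for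
     the one-block polymer system `Loc K j h i :=` the level-`i` blocks, `treeLen := 0`, `z = 1`; `PolymerT3 F` has no axioms and 3″′ lets the prover choose `π`)
  `∧ PintSupH D b₀ p₀ C_P` (SINGLE-run size of the total on the window = `PintSize ∧ AdmOnSmall` read at height `n`; `PintSize` is p513495 at the v3 datum)
  `∧ GlobalSupRateT D b₀ p₀ a C_G` (THE content: `|PintH (K+1) n V − PintH K n V − c K n| ≤ C_G·θ(n)²·#Site(F.P n)·L^{−a(K−n)}` on the `θ(n)`-window)
  `→ ∃ PT, PintDecompTrivT D PT ∧ TwoRunMinT D PT b₀ p₀ a`.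
The witness `topPT` books the whole interaction `Pint K j triv W` at the TOP term level `i = j` (domains = cells of the comparison lattice, probability weights
`e^{−κ₁𝓛(Y)}/Z`) and `0` below: (43) is a one-term identity, the size row `TermSizeTrivT` is the single-run size of the total, and the per-polymer two-run row
`PolymerCauchyMinAtT` compares only the two tops — it IS the global rate-`a` bound (constant `C_G/z`, shifts `w(Y)·c K n`).  §1–§3 give a second witness, the
DIAGONAL sink `sinkPT` (two-run differences `PintH (K−i+1) − PintH (K−i)` booked at level `i`, (43) by telescoping, per-polymer row with budget ZERO — the socket
never compares run `K+1`'s level 1), which needs the rate-ONE bound `GlobalSupTwoRunPintT` because the size row is rigid.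

CONSEQUENCE FOR THE ROUTE (negation-lens finding F-C7, for the owner / the 3″′ pen / NODE O): in 3″′ `∃ p, pins ∧ ∃ π PT, PintDecompTrivT (dataOfV3 p π) PT ∧
TwoRunMinT (dataOfV3 p π) PT b₀ p₀ a` the per-polymer structure (`π`, `PT`, `κ₁`, `LocMatched`, chart/graph matching, the lane's polymer supports) is NOT
load-bearing: given the landed single-run rows, (B)∧(C) under one `∃ π PT` ⟸ `GlobalSupRateT (dataOfV3 p π_blk) b₀ p₀ a C` (this file), and ⟹ the same
content in summed/a.e. form by the registered S-E″ counting (p509040 chain).  So the crux's two-run input is EXACTLY «the total trivial-history interaction at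
height n is cut-off-Cauchy at relative rate L^{−a·k}, uniformly on the θ(n)-window, with the extensive constant» — one inequality per `(K, n)` on the lane's
`pintOfSeries`; OWNER RULING g20-№4 AMENDMENT C (ii) («the lane's series object exposes no polymer supports to read π/PT off») is therefore no obstacle.
WHAT THIS IS NOT: no estimate of Bałaban's or King's is asserted or proved; `GlobalSupRateT`/`GlobalSupTwoRunPintT`/`PintSupH` are hypothesis schemas
(`GlobalSup…` located, UNPRINTED for non-abelian d = 3 — [King1986] Prop. 3.9 p.665 + p.675 is the abelian-Higgs analogue, `a = γ ∈ (0,1)`); it does not make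
3″′ trivial (single-run facts give `|Δ PintH| ≲ θ²·#Site(F.P n)`, the two-run content is the factor `L^{−a(K−n)}`); nothing registered changes.
References: T. Bałaban, CMP 102 (1985) 255–275 [Balaban1985UV3] ((43)–(46) pp.266–267); C. King, CMP 102 (1986) 649–677 [King1986] (Prop. 3.9 p.665, p.675).
-/

noncomputable section

open MeasureTheory Filter Topology
open Literature.MathematicalPhysics.QuantumFieldTheory.Balaban1983to89
open Literature.MathematicalPhysics.QuantumFieldTheory.Balaban1983to89.T3ContinuumYM3Torus
open Literature.MathematicalPhysics.QuantumFieldTheory.Balaban1983to89.T3LevelShift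
open Literature.MathematicalPhysics.QuantumFieldTheory.Balaban1983to89.T3UnitScaleTilt
open Literature.MathematicalPhysics.QuantumFieldTheory.Balaban1983to89.T3AlphaInputsAC
open Literature.MathematicalPhysics.QuantumFieldTheory.Balaban1983to89.T3AlphaPolymerSocket
open Literature.MathematicalPhysics.QuantumFieldTheory.Balaban1983to89.T3AlphaInputsACTwoRunLevel

namespace Summit.QuantumFields.YangMills.Cruxes.FluctuationComparisonRegPr.Ideate2Sink

variable {F : T3Family} {γ : ℝ}

/-! ## §1 The global sup two-run bound, the two geometric clauses, the sink term function -/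

section Defs

variable (D : AlphaDataT3 F γ)

/-- **THE GLOBAL SUP TWO-RUN BOUND ON THE TOTAL TRIVIAL-HISTORY INTERACTION** (hypothesis schema, never asserted): for `n ≤ K′` and every
`θ(n)`-small datum `V` of the height-`n` lattice, `|PintH (K′+1) n V − PintH K′ n V| ≤ C·θ(n+1)²·#Site(F.P K′)·L^{−4(K′−n)}` — the natural size
`θ²·(number of unit cells at height n) = θ²·#Site(F.P K′)·L^{−3(K′−n)}` times the lattice artefact `L^{−(K′−n)}` of the run-`K′` cut-off seen from
height `n`.  [King1986] Prop. 3.9 (3.73)–(3.75) p.665 summed over slices is the abelian-Higgs analogue; unprinted for non-abelian d = 3.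
[cite: King1986, Prop. 3.9 (3.73)-(3.75) p.665] -/
def GlobalSupTwoRunPintT (b₀ p₀ C : ℝ) : Prop :=
  ∀ (K n : ℕ), n ≤ K → ∀ V : GaugeField (F.P n) 0 (Matrix.specialUnitaryGroup (Fin 2) ℂ), PlaqSmall (θBal F.L γ b₀ p₀ n) V →
    |D.PintH (K + 1) n V - D.PintH K n V| ≤
      C * θBal F.L γ b₀ p₀ (n + 1) ^ 2 * (Fintype.card (Site (F.P K) 0) : ℝ) * (((F.L : ℝ) ^ (K - n))⁻¹) ^ 4

/-- **REFINEMENT PRESERVES THE TREE LENGTH** (hypothesis schema on `Loc`/`treeLen`, never asserted): print's `𝓛(Y)` is the length of a shortest tree on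
the centres of the big blocks of `Y` scaled to unit cubes ((24) p.262) — a function of the physical region, hence the same for `Y` (run `K`, level `i`)
and `refineSet Y` (run `K+1`, level `i+1`). [cite: Balaban1985UV3, (24) p.262] -/
def TreeLenMatched : Prop :=
  ∀ K n : ℕ, n ≤ K → ∀ i : ℕ, 1 ≤ i → i ≤ K - n → ∀ Y ∈ D.Loc K (K - n) (D.triv K (K - n)) i,
    D.treeLen (K + 1) (i + 1) (refineSet F K Y) = D.treeLen K i Y

/-- The `e^{−κ₁𝓛}`-mass of the level-`i` localisation domains of run `K` at the trivial history below level `j` (bookkeeping).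
[cite: Balaban1985UV3, (45) p.267] -/
def locZ (κ₁ : ℝ) (K j i : ℕ) : ℝ :=
  ∑ Y ∈ D.Loc K j (D.triv K j) i, Real.exp (-κ₁ * D.treeLen K i Y)

/-- **THE DOMAINS HAVE MASS** (hypothesis schema on `Loc`/`treeLen`, never asserted): for `1 ≤ i ≤ j ≤ K` the `e^{−κ₁𝓛}`-mass of the level-`i`
domains is at least `z ×` the number `#Site(F.P (K−i))` of level-`i` blocks of run `K` (single big blocks are localisation domains with `𝓛 = 0`,
(24) p.262, so `z = M₁^{−3}` in print; `z = 1` for the one-block system). [cite: Balaban1985UV3, (24) p.262] -/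
def LocMass (κ₁ z : ℝ) : Prop :=
  ∀ K j : ℕ, j ≤ K → ∀ i : ℕ, 1 ≤ i → i ≤ j → z * (Fintype.card (Site (F.P (K - i)) 0) : ℝ) ≤ locZ D κ₁ K j i

/-- The sink's probability weights `e^{−κ₁𝓛(Y)}/Z`. [cite: Balaban1985UV3, (45) p.267] -/
def sinkW (κ₁ : ℝ) (K j i : ℕ) (Y : Set (Site (F.P K) 0)) : ℝ :=
  Real.exp (-κ₁ * D.treeLen K i Y) / locZ D κ₁ K j i

/-- A level-`j` field of run `K` read DOWN on the finest lattice of run `K − j` (same modulus). [cite: Balaban1987RG1, (0.1) p.251] -/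
def readDown {K j : ℕ} (h : j ≤ K) (W : GaugeField (F.P K) j (Matrix.specialUnitaryGroup (Fin 2) ℂ)) :
    GaugeField (F.P (K - j)) 0 (Matrix.specialUnitaryGroup (Fin 2) ℂ) :=
  fieldShift (F.sitesPerDir_eq (m := F.m) (K := K - j) (j := 0) (m' := F.m) (K' := K) (j' := j) (by omega)) W

/-- The two-run difference of the total trivial-history interaction at height `n`, run `K′+1` against run `K′`. [cite: Balaban1985UV3, (43) p.266] -/
def pintStep (K' n : ℕ) (V : GaugeField (F.P n) 0 (Matrix.specialUnitaryGroup (Fin 2) ℂ)) : ℝ :=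
  D.PintH (K' + 1) n V - D.PintH K' n V

/-- **THE SINK TERM FUNCTION**: for `j ≤ K`, the level-`i` "term" of the domain `Y` in run `K`'s level-`j` action is the two-run difference
`PintH (K−i+1) (K−j) − PintH (K−i) (K−j)` of the TOTAL interaction at height `K − j`, spread over the level-`i` domains with the weights `e^{−κ₁𝓛(Y)}/Z`;
above the cut-off (`j > K`, never read by any socket except (43)) it is the given `PT₀`. [cite: Balaban1985UV3, (43) p.266] -/
def sinkPT (κ₁ : ℝ) (PT₀ : TermFn F) : TermFn F := fun K j i Y W =>
  if h : j ≤ K then sinkW D κ₁ K j i Y * pintStep D (K - i) (K - j) (readDown h W) else PT₀ K j i Y W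

end Defs

/-! ## §2 Bookkeeping lemmas -/

section Lemmas

variable (D : AlphaDataT3 F γ)

/-- `Pint K 0 triv = 0` from (43) at the trivial history (empty sum), in the cast-free form `j = 0 → …`. [cite: Balaban1985UV3, (43) p.266] -/
theorem pint_triv_eq_zero_of_decomp {PT₀ : TermFn F} (h₀ : PintDecompTrivT D PT₀) {K j : ℕ} (hj : j = 0)
    (W : GaugeField (F.P K) j (Matrix.specialUnitaryGroup (Fin 2) ℂ)) : D.Pint K j (D.triv K j) W = 0 := by
  subst hj
  rw [h₀, Finset.Icc_eq_empty (by omega), Finset.sum_empty]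

/-- The height reading at the cut-off's own height vanishes: `PintH K K V = 0`. [cite: Balaban1985UV3, (43) p.266] -/
theorem pintH_self_eq_zero {PT₀ : TermFn F} (h₀ : PintDecompTrivT D PT₀) (n : ℕ)
    (V : GaugeField (F.P n) 0 (Matrix.specialUnitaryGroup (Fin 2) ℂ)) : D.PintH n n V = 0 := by
  rw [D.PintH_of_le le_rfl]
  exact pint_triv_eq_zero_of_decomp D h₀ (Nat.sub_self n) _

/-- Round trip: reading a level-`j` field down and up again gives it back (cast-free form). [cite: Balaban1987RG1, (0.1) p.251] -/
theorem pintTriv_shift_roundtrip {K j j' n : ℕ} (hj : j' = j)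
    (h1 : (F.PP F.m K).sitesPerDir j' = (F.PP F.m n).sitesPerDir 0) (h2 : (F.PP F.m n).sitesPerDir 0 = (F.PP F.m K).sitesPerDir j)
    (W : GaugeField (F.P K) j (Matrix.specialUnitaryGroup (Fin 2) ℂ)) :
    D.PintTriv K j' (fieldShift h1 (fieldShift h2 W)) = D.PintTriv K j W := by
  subst hj
  rw [fieldShift_fieldShift, fieldShift_refl]

/-- The height reading of a field read down is the interaction itself: `PintH K (K−j) (readDown W) = Pint K j triv W`. [cite: Balaban1985UV3, (43) p.266] -/
theorem pintH_readDown {K j : ℕ} (h : j ≤ K) (W : GaugeField (F.P K) j (Matrix.specialUnitaryGroup (Fin 2) ℂ)) :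
    D.PintH K (K - j) (readDown h W) = D.Pint K j (D.triv K j) W := by
  rw [D.PintH_of_le (Nat.sub_le K j)]
  unfold readDown
  exact pintTriv_shift_roundtrip D (by omega) _ _ W

/-- `pintStep` is insensitive to a trivial re-reading of the height lattice (cast-free form). [cite: Balaban1987RG1, (0.1) p.251] -/
theorem pintStep_shift {K' n n' : ℕ} (e : n' = n) (hs : (F.PP F.m n').sitesPerDir 0 = (F.PP F.m n).sitesPerDir 0)
    (V : GaugeField (F.P n) 0 (Matrix.specialUnitaryGroup (Fin 2) ℂ)) :
    pintStep D K' n' (fieldShift hs V) = pintStep D K' n V := by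
  subst e
  rw [fieldShift_refl]

/-- The sink read at a datum read UP to run `K`'s level `K − n` is the weight times the two-run difference at height `n`. [cite: Balaban1985UV3, (43) p.266] -/
theorem sinkPT_up (κ₁ : ℝ) (PT₀ : TermFn F) {K n : ℕ} (h : n ≤ K) (i : ℕ) (Y : Set (Site (F.P K) 0))
    (V : GaugeField (F.P n) 0 (Matrix.specialUnitaryGroup (Fin 2) ℂ)) :
    sinkPT D κ₁ PT₀ K (K - n) i Y
        (fieldShift (F.sitesPerDir_eq (m := F.m) (K := K) (j := K - n) (m' := F.m) (K' := n) (j' := 0) (by omega)) V) =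
      sinkW D κ₁ K (K - n) i Y * pintStep D (K - i) n V := by
  simp only [sinkPT, dif_pos (Nat.sub_le K n), readDown, fieldShift_fieldShift]
  rw [pintStep_shift D (show K - (K - n) = n by omega)]

/-- The mass of the domains is positive under `LocMass` with `z > 0`. [cite: Balaban1985UV3, (24) p.262] -/
theorem locZ_pos {κ₁ z : ℝ} (hz : 0 < z) (hmass : LocMass D κ₁ z) {K j : ℕ} (h : j ≤ K) {i : ℕ} (hi1 : 1 ≤ i) (hi2 : i ≤ j) :
    0 < locZ D κ₁ K j i :=
  lt_of_lt_of_le (mul_pos hz (Nat.cast_pos.mpr Fintype.card_pos)) (hmass K j h i hi1 hi2)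

/-- The sink weights are non-negative (given positive mass). [cite: Balaban1985UV3, (45) p.267] -/
theorem sinkW_nonneg {κ₁ : ℝ} {K j i : ℕ} (hZ : 0 < locZ D κ₁ K j i) (Y : Set (Site (F.P K) 0)) : 0 ≤ sinkW D κ₁ K j i Y :=
  div_nonneg (Real.exp_pos _).le hZ.le

/-- The sink weights sum to one. [cite: Balaban1985UV3, (45) p.267] -/
theorem sum_sinkW {κ₁ : ℝ} {K j i : ℕ} (hZ : 0 < locZ D κ₁ K j i) : ∑ Y ∈ D.Loc K j (D.triv K j) i, sinkW D κ₁ K j i Y = 1 := by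
  unfold sinkW
  rw [← Finset.sum_div]
  exact div_self hZ.ne'

/-- Matched domains with matched tree lengths have the same mass one cut-off finer. [cite: Balaban1985UV3, (24) p.262] -/
theorem locZ_succ {κ₁ : ℝ} (hM : LocMatched D) (hT : TreeLenMatched D) {K n : ℕ} (h : n ≤ K) {i : ℕ} (hi1 : 1 ≤ i) (hi2 : i ≤ K - n) :
    locZ D κ₁ (K + 1) (K + 1 - n) (i + 1) = locZ D κ₁ K (K - n) i := by
  unfold locZ
  have hbij := hM K n h i hi1 hi2
  symm
  exact Finset.sum_nbij (refineSet F K) (fun Y hY => hbij.mapsTo hY) (fun Y₁ h₁ Y₂ h₂ h12 => hbij.injOn h₁ h₂ h12)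
    (fun Y' hY' => hbij.surjOn hY') (fun Y hY => by rw [hT K n h i hi1 hi2 Y hY])

/-- Matched domains carry the same sink weight. [cite: Balaban1985UV3, (24) p.262] -/
theorem sinkW_succ {κ₁ : ℝ} (hM : LocMatched D) (hT : TreeLenMatched D) {K n : ℕ} (h : n ≤ K) {i : ℕ} (hi1 : 1 ≤ i) (hi2 : i ≤ K - n)
    {Y : Set (Site (F.P K) 0)} (hY : Y ∈ D.Loc K (K - n) (D.triv K (K - n)) i) :
    sinkW D κ₁ (K + 1) (K + 1 - n) (i + 1) (refineSet F K Y) = sinkW D κ₁ K (K - n) i Y := by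
  unfold sinkW
  rw [locZ_succ D hM hT h hi1 hi2, hT K n h i hi1 hi2 Y hY]

end Lemmas

/-! ## §3 The three rows for the sink, and the bundle -/

section Rows

variable (D : AlphaDataT3 F γ)

/-- **(43) AT THE TRIVIAL HISTORY FOR THE SINK IS A TELESCOPING IDENTITY**: `Σ_{i=1}^{j} Σ_Y sinkPT = Σ_{i=1}^{j} (PintH (K−i+1) − PintH (K−i)) (K−j)
= PintH K (K−j) − PintH (K−j) (K−j) = Pint K j triv W − 0`. [cite: Balaban1985UV3, (43) p.266] -/
theorem pintDecompTrivT_sinkPT {PT₀ : TermFn F} {κ₁ z : ℝ} (h₀ : PintDecompTrivT D PT₀) (hz : 0 < z) (hmass : LocMass D κ₁ z) :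
    PintDecompTrivT D (sinkPT D κ₁ PT₀) := by
  intro K j W
  by_cases h : j ≤ K
  · have hinner : ∀ i ∈ Finset.Icc 1 j, ∑ Y ∈ D.Loc K j (D.triv K j) i, sinkPT D κ₁ PT₀ K j i Y W =
        pintStep D (K - i) (K - j) (readDown h W) := by
      intro i hi
      rw [Finset.mem_Icc] at hi
      simp only [sinkPT, dif_pos h]
      rw [← Finset.sum_mul, sum_sinkW D (locZ_pos D hz hmass h hi.1 hi.2), one_mul]
    rw [Finset.sum_congr rfl hinner, ← Finset.Ico_add_one_right_eq_Icc, Finset.sum_Ico_eq_sum_range, Nat.add_sub_cancel]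
    have hstep : ∀ t ∈ Finset.range j, pintStep D (K - (1 + t)) (K - j) (readDown h W) =
        D.PintH (K - t) (K - j) (readDown h W) - D.PintH (K - (t + 1)) (K - j) (readDown h W) := by
      intro t ht
      rw [Finset.mem_range] at ht
      unfold pintStep
      rw [show K - (1 + t) + 1 = K - t by omega, show 1 + t = t + 1 by omega]
    rw [Finset.sum_congr rfl hstep, Finset.sum_range_sub', Nat.sub_zero, pintH_readDown D h W,
      pintH_self_eq_zero D h₀, sub_zero]
  · simp only [sinkPT, dif_neg h]
    exact h₀ K j W

/-- **THE SIZE ROW FOR THE SINK IS THE GLOBAL SUP TWO-RUN BOUND** (constant `C/z`). [cite: King1986, Prop. 3.9 (3.73)-(3.75) p.665] -/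
theorem termSizeTrivT_sinkPT {PT₀ : TermFn F} {b₀ p₀ κ₁ z C : ℝ} (hκ : 0 < κ₁) (hz : 0 < z) (hmass : LocMass D κ₁ z) (hC : 0 ≤ C)
    (hG : GlobalSupTwoRunPintT D b₀ p₀ C) : TermSizeTrivT D (sinkPT D κ₁ PT₀) b₀ p₀ (C / z) κ₁ := by
  refine ⟨hκ, fun K n h V hV i hi1 hi2 Y hY => ?_⟩
  have hZ : 0 < locZ D κ₁ K (K - n) i := locZ_pos D hz hmass (Nat.sub_le K n) hi1 hi2
  have hm : z * (Fintype.card (Site (F.P (K - i)) 0) : ℝ) ≤ locZ D κ₁ K (K - n) i := hmass K (K - n) (Nat.sub_le K n) i hi1 hi2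
  have hΔ : |pintStep D (K - i) n V| ≤ C * θBal F.L γ b₀ p₀ (n + 1) ^ 2 * (Fintype.card (Site (F.P (K - i)) 0) : ℝ) *
      (((F.L : ℝ) ^ (K - n - i))⁻¹) ^ 4 := by
    have := hG (K - i) n (by omega) V hV
    rw [show K - i - n = K - n - i by omega] at this
    exact this
  rw [sinkPT_up D κ₁ PT₀ h i Y V, abs_mul, abs_of_nonneg (sinkW_nonneg D hZ Y)]
  set e : ℝ := Real.exp (-κ₁ * D.treeLen K i Y) with he
  set θ2 : ℝ := θBal F.L γ b₀ p₀ (n + 1) ^ 2 with hθ2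
  set r : ℝ := (((F.L : ℝ) ^ (K - n - i))⁻¹) ^ 4 with hr
  set N : ℝ := (Fintype.card (Site (F.P (K - i)) 0) : ℝ) with hN
  set Z : ℝ := locZ D κ₁ K (K - n) i with hZdef
  have hsw : sinkW D κ₁ K (K - n) i Y = e / Z := rfl
  have he0 : 0 ≤ e := (Real.exp_pos _).le
  have hθ0 : 0 ≤ θ2 := by rw [hθ2]; positivity
  have hr0 : 0 ≤ r := by rw [hr]; positivity
  calc sinkW D κ₁ K (K - n) i Y * |pintStep D (K - i) n V|
      ≤ sinkW D κ₁ K (K - n) i Y * (C * θ2 * N * r) := mul_le_mul_of_nonneg_left hΔ (sinkW_nonneg D hZ Y)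
    _ = (C * e * θ2 * r) * (N / Z) := by rw [hsw]; ring
    _ ≤ (C * e * θ2 * r) * (1 / z) := by
        apply mul_le_mul_of_nonneg_left _ (by positivity)
        rw [div_le_div_iff₀ hZ hz, one_mul, mul_comm]
        exact hm
    _ = C / z * e * θ2 * r := by ring

/-- **THE PER-POLYMER TWO-RUN ROW FOR THE SINK HOLDS WITH BUDGET ZERO**: matched domains carry identical terms (the socket compares run `K+1`'s
level `i+1` with run `K`'s level `i`, `i ≥ 1`, never run `K+1`'s level 1). [cite: King1986, Prop. 3.9 (3.73)-(3.75) p.665] -/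
theorem polymerCauchyMinAtT_sinkPT {PT₀ : TermFn F} {b₀ p₀ κ₁ : ℝ} (a : ℝ) (hM : LocMatched D) (hT : TreeLenMatched D) :
    PolymerCauchyMinAtT D (sinkPT D κ₁ PT₀) b₀ p₀ κ₁ a 0 := by
  refine ⟨fun _ _ _ _ => 0, fun K n h j hj V _ Y hY => ?_⟩
  have h' : n ≤ K + 1 := by omega
  rw [sinkPT_up D κ₁ PT₀ h (1 + j) Y V]
  have hup := sinkPT_up D κ₁ PT₀ h' (1 + (j + 1)) (refineSet F K Y) V
  rw [show K + 1 - (1 + (j + 1)) = K - (1 + j) by omega] at hup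
  rw [hup, show (1 + (j + 1) : ℕ) = 1 + j + 1 by omega, sinkW_succ D hM hT h (i := 1 + j) (by omega) (by omega) hY]
  simp

/-- **THE BUNDLE FOR THE SINK**: `PintDecompTrivT ∧ TwoRunMinT` at EVERY exponent `a`, from the global sup two-run bound and geometry alone.
[cite: King1986, Prop. 3.9 (3.73)-(3.75) p.665] -/
theorem twoRunMinT_sinkPT {PT₀ : TermFn F} {b₀ p₀ κ₁ C' z C : ℝ} (a : ℝ)
    (h₀ : PintDecompTrivT D PT₀) (hκ : 0 < κ₁) (hcov : LocCover D κ₁ C') (hvol : LocBlockVolume D) (hM : LocMatched D)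
    (hT : TreeLenMatched D) (hz : 0 < z) (hmass : LocMass D κ₁ z) (hC : 0 ≤ C) (hG : GlobalSupTwoRunPintT D b₀ p₀ C) :
    PintDecompTrivT D (sinkPT D κ₁ PT₀) ∧ TwoRunMinT D (sinkPT D κ₁ PT₀) b₀ p₀ a :=
  ⟨pintDecompTrivT_sinkPT D h₀ hz hmass,
    κ₁, ⟨C / z, termSizeTrivT_sinkPT D hκ hz hmass hC hG⟩, ⟨C', hcov⟩, hvol, hM, ⟨0, polymerCauchyMinAtT_sinkPT D a hM hT⟩⟩

/-- **THE EXISTENTIAL FORM READ BY STUB 3″′**: under the hypotheses of `twoRunMinT_sinkPT`, `∃ PT, PintDecompTrivT D PT ∧ TwoRunMinT D PT b₀ p₀ a`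
for every `a` — in particular with `a = 1` the S-E″ consumer `LogComparisonLevelCauchyMinT.polymerCauchyAtT_of_twoRunMinT` runs at every `m ≥ 5`.
[cite: King1986, Prop. 3.9 (3.73)-(3.75) p.665] -/
theorem exists_termFn_twoRunMinT {PT₀ : TermFn F} {b₀ p₀ κ₁ C' z C : ℝ} (a : ℝ)
    (h₀ : PintDecompTrivT D PT₀) (hκ : 0 < κ₁) (hcov : LocCover D κ₁ C') (hvol : LocBlockVolume D) (hM : LocMatched D)
    (hT : TreeLenMatched D) (hz : 0 < z) (hmass : LocMass D κ₁ z) (hC : 0 ≤ C) (hG : GlobalSupTwoRunPintT D b₀ p₀ C) :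
    ∃ PT : TermFn F, PintDecompTrivT D PT ∧ TwoRunMinT D PT b₀ p₀ a :=
  ⟨sinkPT D κ₁ PT₀, twoRunMinT_sinkPT D a h₀ hκ hcov hvol hM hT hz hmass hC hG⟩

end Rows

/-! ## §4 THE TOP SINK — the weakest form: ANY relative rate `L^{−a·k}` on the total (print's `γ < 1` admissible)

The diagonal sink of §1–§3 needs the rate-ONE bound `GlobalSupTwoRunPintT` because the size row `TermSizeTrivT` is rigid (exponent `4 = 3 + 1`).  Booking the
WHOLE trivial-history interaction `Pint K j triv W` at the TOP term level `i = j` (domains = cells of the comparison lattice, weights `e^{−κ₁𝓛}/Z`) and `0` at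
every lower level does better: (43) is then a one-term identity, the size row is the SINGLE-RUN size of the total (`PintSupH`, = the package's `PintSize ∧
AdmOnSmall` read at height `n`), and the per-polymer two-run row compares only the two tops, i.e. it is EXACTLY the global two-run bound at relative rate
`L^{−a(K−n)}` (`GlobalSupRateT … a`), for every `a > 0` — [King1986] Prop. 3.9's `L^{−γk}`, `0 < γ < 1`, included. -/

section TopSink

variable (D : AlphaDataT3 F γ)

/-- `Pint K 0 triv ≡ 0` (for the v3 family datum this is `AlphaInputsT3AC.dataOfV3_pint_zero`, `rfl`). [cite: Balaban1985UV3, (1) p.256] -/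
def PintZero : Prop :=
  ∀ K (W : GaugeField (F.P K) 0 (Matrix.specialUnitaryGroup (Fin 2) ℂ)), D.Pint K 0 (D.triv K 0) W = 0

/-- (43) at the trivial history ABOVE THE CUT-OFF ONLY (`j > K`, the socket's junk range; a dump term function discharges it whenever the level-1 domain lists
are non-empty). [cite: Balaban1985UV3, (43) p.266] -/
def PintDecompAboveT (PT₀ : TermFn F) : Prop :=
  ∀ K j (W : GaugeField (F.P K) j (Matrix.specialUnitaryGroup (Fin 2) ℂ)), K < j →
    D.Pint K j (D.triv K j) W = ∑ i ∈ Finset.Icc 1 j, ∑ Y ∈ D.Loc K j (D.triv K j) i, PT₀ K j i Y W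

/-- **THE SINGLE-RUN SIZE OF THE TOTAL TRIVIAL-HISTORY INTERACTION AT HEIGHT `n`** (hypothesis schema, never asserted; = `PintSize ∧ AdmOnSmall` of the package
read through `PintH`): `|PintH K n V| ≤ C·θ(n+1)²·#Site(F.P n)` on the `θ(n)`-window — (46) p.267 «Σ_j Σ_{Y_j} |𝒫_j(Y_j, U_k)| ≤ O(1)M₁³g²_{k−1}p²(g_{k−1})|Λ_k|».
[cite: Balaban1985UV3, (46) p.267] -/
def PintSupH (b₀ p₀ C : ℝ) : Prop :=
  ∀ (K n : ℕ), n ≤ K → ∀ V : GaugeField (F.P n) 0 (Matrix.specialUnitaryGroup (Fin 2) ℂ), PlaqSmall (θBal F.L γ b₀ p₀ n) V →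
    |D.PintH K n V| ≤ C * θBal F.L γ b₀ p₀ (n + 1) ^ 2 * (Fintype.card (Site (F.P n) 0) : ℝ)

/-- **THE GLOBAL TWO-RUN BOUND AT RELATIVE RATE `L^{−a·k}`** (hypothesis schema, never asserted): on the `θ(n)`-window,
`|PintH (K+1) n V − PintH K n V − c K n| ≤ C·θ(n)²·#Site(F.P n)·L^{−a(K−n)}` with DATUM-INDEPENDENT shifts `c K n` (vacuum-energy bookkeeping) — the
natural extensive size times the relative lattice artefact of the run-`K` cut-off seen from height `n`; [King1986] Prop. 3.9 (3.73)–(3.75) p.665 + p.675 summed over slices and cells is the abelian-Higgs analogue with `a = γ ∈ (0,1)`.  UNPRINTED for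
non-abelian d = 3: this is the honest analytic content of the crux's two-run input. [cite: King1986, Prop. 3.9 (3.73)-(3.75) p.665] -/
def GlobalSupRateT (b₀ p₀ a C : ℝ) : Prop :=
  ∃ c : ℕ → ℕ → ℝ, ∀ (K n : ℕ), n ≤ K → ∀ V : GaugeField (F.P n) 0 (Matrix.specialUnitaryGroup (Fin 2) ℂ), PlaqSmall (θBal F.L γ b₀ p₀ n) V →
    |D.PintH (K + 1) n V - D.PintH K n V - c K n| ≤
      C * θBal F.L γ b₀ p₀ n ^ 2 * (Fintype.card (Site (F.P n) 0) : ℝ) * (((F.L : ℝ) ^ (K - n))⁻¹) ^ a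

/-- **THE TOP SINK**: below the cut-off, the whole trivial-history interaction booked at the top term level `i = j` with the weights `e^{−κ₁𝓛}/Z`, zero at
every lower level; the given `PT₀` above the cut-off. [cite: Balaban1985UV3, (43) p.266] -/
def topPT (κ₁ : ℝ) (PT₀ : TermFn F) : TermFn F := fun K j i Y W =>
  if j ≤ K then (if i = j then sinkW D κ₁ K j j Y * D.PintTriv K j W else 0) else PT₀ K j i Y W

/-- `PintDecompTrivT D PT₀` splits into `PintZero` and the above-cut-off part (what the sinks use of it). [cite: Balaban1985UV3, (43) p.266] -/
theorem pintZero_and_above_of_decomp {PT₀ : TermFn F} (h₀ : PintDecompTrivT D PT₀) : PintZero D ∧ PintDecompAboveT D PT₀ :=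
  ⟨fun _ W => pint_triv_eq_zero_of_decomp D h₀ rfl W, fun K j W _ => h₀ K j W⟩

/-- The number of sites of the finest lattice depends on the run index only through its value (cast-free transport). [folklore] -/
theorem card_site_congr {a b : ℕ} (e : a = b) : Fintype.card (Site (F.P a) 0) = Fintype.card (Site (F.P b) 0) := by
  subst e
  rfl

/-- Matched top weights (`i = K − n`, `i + 1 = K + 1 − n`). [cite: Balaban1985UV3, (24) p.262] -/
theorem sinkW_succ_top {κ₁ : ℝ} (hM : LocMatched D) (hT : TreeLenMatched D) {K n : ℕ} (h : n ≤ K) (hk : 1 ≤ K - n)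
    {Y : Set (Site (F.P K) 0)} (hY : Y ∈ D.Loc K (K - n) (D.triv K (K - n)) (K - n)) :
    sinkW D κ₁ (K + 1) (K + 1 - n) (K + 1 - n) (refineSet F K Y) = sinkW D κ₁ K (K - n) (K - n) Y := by
  have := sinkW_succ D (κ₁ := κ₁) hM hT h (i := K - n) hk le_rfl hY
  rwa [show K - n + 1 = K + 1 - n by omega] at this

/-- **(43) FOR THE TOP SINK** (one-term identity below the cut-off; `PintZero` at `j = 0`; `PT₀` above). [cite: Balaban1985UV3, (43) p.266] -/
theorem pintDecompTrivT_topPT {PT₀ : TermFn F} {κ₁ z : ℝ} (h0 : PintZero D) (hjunk : PintDecompAboveT D PT₀) (hz : 0 < z) (hmass : LocMass D κ₁ z) :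
    PintDecompTrivT D (topPT D κ₁ PT₀) := by
  intro K j W
  by_cases hK : j ≤ K
  · simp only [topPT, if_pos hK]
    rcases Nat.eq_zero_or_pos j with hj | hj
    · subst hj
      rw [h0, Finset.Icc_eq_empty (by omega), Finset.sum_empty]
    · have hZ : 0 < locZ D κ₁ K j j := locZ_pos D hz hmass hK hj le_rfl
      have hinner : ∀ i ∈ Finset.Icc 1 j, (∑ Y ∈ D.Loc K j (D.triv K j) i, if i = j then sinkW D κ₁ K j j Y * D.PintTriv K j W else 0) =
          if i = j then D.PintTriv K j W else 0 := by
        intro i _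
        split_ifs with hij
        · subst hij
          rw [← Finset.sum_mul, sum_sinkW D hZ, one_mul]
        · simp
      rw [Finset.sum_congr rfl hinner, Finset.sum_ite_eq' (Finset.Icc 1 j) j (fun _ => D.PintTriv K j W),
        if_pos (Finset.mem_Icc.mpr ⟨hj, le_rfl⟩)]
      rfl
  · simp only [topPT, if_neg hK]
    exact hjunk K j W (by omega)

/-- **THE SIZE ROW FOR THE TOP SINK IS THE SINGLE-RUN SIZE OF THE TOTAL** (constant `C/z`). [cite: Balaban1985UV3, (46) p.267] -/
theorem termSizeTrivT_topPT {PT₀ : TermFn F} {b₀ p₀ κ₁ z C : ℝ} (hκ : 0 < κ₁) (hz : 0 < z) (hmass : LocMass D κ₁ z) (hC : 0 ≤ C)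
    (hP : PintSupH D b₀ p₀ C) : TermSizeTrivT D (topPT D κ₁ PT₀) b₀ p₀ (C / z) κ₁ := by
  refine ⟨hκ, fun K n h V hV i hi1 hi2 Y hY => ?_⟩
  simp only [topPT, if_pos (Nat.sub_le K n)]
  split_ifs with hi
  · subst hi
    have hZ : 0 < locZ D κ₁ K (K - n) (K - n) := locZ_pos D hz hmass (Nat.sub_le K n) hi1 le_rfl
    have hm : z * (Fintype.card (Site (F.P n) 0) : ℝ) ≤ locZ D κ₁ K (K - n) (K - n) := by
      have := hmass K (K - n) (Nat.sub_le K n) (K - n) hi1 le_rfl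
      rwa [card_site_congr (Nat.sub_sub_self h)] at this
    rw [← D.PintH_of_le h, abs_mul, abs_of_nonneg (sinkW_nonneg D hZ Y), show K - n - (K - n) = 0 by omega, pow_zero, inv_one, one_pow, mul_one]
    have hΔ := hP K n h V hV
    set e : ℝ := Real.exp (-κ₁ * D.treeLen K (K - n) Y)
    set θ2 : ℝ := θBal F.L γ b₀ p₀ (n + 1) ^ 2 with hθ2
    set N : ℝ := (Fintype.card (Site (F.P n) 0) : ℝ)
    set Z : ℝ := locZ D κ₁ K (K - n) (K - n)
    have hsw : sinkW D κ₁ K (K - n) (K - n) Y = e / Z := rfl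
    have hθ0 : 0 ≤ θ2 := by rw [hθ2]; positivity
    calc sinkW D κ₁ K (K - n) (K - n) Y * |D.PintH K n V|
        ≤ sinkW D κ₁ K (K - n) (K - n) Y * (C * θ2 * N) := mul_le_mul_of_nonneg_left hΔ (sinkW_nonneg D hZ Y)
      _ = (C * e * θ2) * (N / Z) := by rw [hsw]; ring
      _ ≤ (C * e * θ2) * (1 / z) := by
          apply mul_le_mul_of_nonneg_left _ (by positivity)
          rw [div_le_div_iff₀ hZ hz, one_mul, mul_comm]
          exact hm
      _ = C / z * e * θ2 := by ring
  · rw [abs_zero]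
    positivity

/-- **THE PER-POLYMER TWO-RUN ROW FOR THE TOP SINK IS THE GLOBAL RATE-`a` BOUND** (only the two tops are compared; constant `C/z`, shifts `0`).
[cite: King1986, Prop. 3.9 (3.73)-(3.75) p.665] -/
theorem polymerCauchyMinAtT_topPT {PT₀ : TermFn F} {b₀ p₀ κ₁ z a C : ℝ} (hM : LocMatched D) (hT : TreeLenMatched D) (hz : 0 < z)
    (hmass : LocMass D κ₁ z) (hC : 0 ≤ C) (hG : GlobalSupRateT D b₀ p₀ a C) :
    PolymerCauchyMinAtT D (topPT D κ₁ PT₀) b₀ p₀ κ₁ a (C / z) := by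
  obtain ⟨c, hc⟩ := hG
  refine ⟨fun K n j Y => if 1 + j = K - n then sinkW D κ₁ K (K - n) (K - n) Y * c K n else 0, fun K n h j hj V hV Y hY => ?_⟩
  have h' : n ≤ K + 1 := by omega
  simp only [topPT, if_pos (Nat.sub_le K n), if_pos (show K + 1 - n ≤ K + 1 by omega)]
  by_cases htop : 1 + j = K - n
  · rw [if_pos htop, if_pos (show 1 + (j + 1) = K + 1 - n by omega), if_pos htop, ← D.PintH_of_le h, ← D.PintH_of_le h']
    have hY' : Y ∈ D.Loc K (K - n) (D.triv K (K - n)) (K - n) := htop ▸ hY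
    rw [sinkW_succ_top D hM hT h (by omega) hY', ← mul_sub, ← mul_sub]
    have hZ : 0 < locZ D κ₁ K (K - n) (K - n) := locZ_pos D hz hmass (Nat.sub_le K n) (by omega) le_rfl
    have hm : z * (Fintype.card (Site (F.P n) 0) : ℝ) ≤ locZ D κ₁ K (K - n) (K - n) := by
      have := hmass K (K - n) (Nat.sub_le K n) (K - n) (by omega) le_rfl
      rwa [card_site_congr (Nat.sub_sub_self h)] at this
    rw [abs_mul, abs_of_nonneg (sinkW_nonneg D hZ Y), show K - n - 1 - j = 0 by omega, pow_zero, inv_one, one_pow, mul_one, htop]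
    have hΔ := hc K n h V hV
    set e : ℝ := Real.exp (-κ₁ * D.treeLen K (K - n) Y)
    set θ2 : ℝ := θBal F.L γ b₀ p₀ n ^ 2 with hθ2
    set N : ℝ := (Fintype.card (Site (F.P n) 0) : ℝ)
    set R : ℝ := (((F.L : ℝ) ^ (K - n))⁻¹) ^ a with hR
    set Z : ℝ := locZ D κ₁ K (K - n) (K - n)
    have hsw : sinkW D κ₁ K (K - n) (K - n) Y = e / Z := rfl
    have hθ0 : 0 ≤ θ2 := by rw [hθ2]; positivity
    have hR0 : 0 ≤ R := by rw [hR]; positivity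
    calc sinkW D κ₁ K (K - n) (K - n) Y * |D.PintH (K + 1) n V - D.PintH K n V - c K n|
        ≤ sinkW D κ₁ K (K - n) (K - n) Y * (C * θ2 * N * R) := mul_le_mul_of_nonneg_left hΔ (sinkW_nonneg D hZ Y)
      _ = (C * e * θ2 * R) * (N / Z) := by rw [hsw]; ring
      _ ≤ (C * e * θ2 * R) * (1 / z) := by
          apply mul_le_mul_of_nonneg_left _ (by positivity)
          rw [div_le_div_iff₀ hZ hz, one_mul, mul_comm]
          exact hm
      _ = C / z * e * θ2 * R := by ring
  · rw [if_neg htop, if_neg (show ¬ (1 + (j + 1) = K + 1 - n) by omega), if_neg htop, sub_zero, sub_zero, abs_zero]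
    positivity

/-- **THE BUNDLE FOR THE TOP SINK, EVERY RATE `a`**: `PintDecompTrivT ∧ TwoRunMinT … a` from `PintZero`, the junk-range decomposition, the geometry of
`Loc`/`treeLen`, the single-run size of the total and the global two-run bound at rate `a` — NOTHING per-polymer. [cite: King1986, Prop. 3.9 (3.73)-(3.75) p.665] -/
theorem twoRunMinT_topPT {PT₀ : TermFn F} {b₀ p₀ κ₁ C' z a C_P C_G : ℝ}
    (h0 : PintZero D) (hjunk : PintDecompAboveT D PT₀) (hκ : 0 < κ₁) (hcov : LocCover D κ₁ C') (hvol : LocBlockVolume D) (hM : LocMatched D)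
    (hT : TreeLenMatched D) (hz : 0 < z) (hmass : LocMass D κ₁ z) (hCP : 0 ≤ C_P) (hP : PintSupH D b₀ p₀ C_P) (hCG : 0 ≤ C_G)
    (hG : GlobalSupRateT D b₀ p₀ a C_G) :
    PintDecompTrivT D (topPT D κ₁ PT₀) ∧ TwoRunMinT D (topPT D κ₁ PT₀) b₀ p₀ a :=
  ⟨pintDecompTrivT_topPT D h0 hjunk hz hmass,
    κ₁, ⟨C_P / z, termSizeTrivT_topPT D hκ hz hmass hCP hP⟩, ⟨C', hcov⟩, hvol, hM, ⟨C_G / z, polymerCauchyMinAtT_topPT D hM hT hz hmass hCG hG⟩⟩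

/-- **THE EXISTENTIAL FORM READ BY STUB 3″′, EVERY RATE `a`.** [cite: King1986, Prop. 3.9 (3.73)-(3.75) p.665] -/
theorem exists_termFn_twoRunMinT_top {PT₀ : TermFn F} {b₀ p₀ κ₁ C' z a C_P C_G : ℝ}
    (h0 : PintZero D) (hjunk : PintDecompAboveT D PT₀) (hκ : 0 < κ₁) (hcov : LocCover D κ₁ C') (hvol : LocBlockVolume D) (hM : LocMatched D)
    (hT : TreeLenMatched D) (hz : 0 < z) (hmass : LocMass D κ₁ z) (hCP : 0 ≤ C_P) (hP : PintSupH D b₀ p₀ C_P) (hCG : 0 ≤ C_G)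
    (hG : GlobalSupRateT D b₀ p₀ a C_G) :
    ∃ PT : TermFn F, PintDecompTrivT D PT ∧ TwoRunMinT D PT b₀ p₀ a :=
  ⟨topPT D κ₁ PT₀, twoRunMinT_topPT D h0 hjunk hκ hcov hvol hM hT hz hmass hCP hP hCG hG⟩

end TopSink

end Summit.QuantumFields.YangMills.Cruxes.FluctuationComparisonRegPr.Ideate2Sink

end
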